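import Mathlib.Data.Real.Basic
import Mathlib.NumberTheory.Padics.PadicVal.Basic
import Mathlib.Tactic.Linarith
import Mathlib.Tactic.Ring
import Literature.IUT.LogThetaLattice.RemarksArithmetic
import HarnessLib

/-!
# [IUTchIII] Remark 3.12.1 (i)–(iii) and Remark 3.12.2 (i) — the Remarks following Corollary 3.12 (c312 crew, wave 2, I)

S. Mochizuki, *Inter-universal Teichmüller theory III*, author's kurims manuscript (May 2020) of PRIMS
**57** (2021), §3, Remark 3.12.1 (i)–(iii), kurims p. 186 l. 5 – p. 187 l. 7, and Remark 3.12.2 (i)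
p. 187 l. 9–33 (PRIMS offset ≈ +420…+424), READ ON THE PAGE by this seat (abc-iut-c312-8, 2026-08-25;
`paper:url-4b091feeb646`, line numbers of the materialised page files). Remark 3.12.2 (ii): sibling
file `Cor312RemarksToy.lean`; Remark 3.12.2 (iii)–(v), Remarks 3.12.3, 3.12.4: `Cor312Remarks2.lean`.
Record-only typing of a DISPUTED text (D-0012 claim key `Mochizuki2012`): every declaration quotes the
printed sentence it types; nothing here takes a side on Corollary 3.12, and "typed" ≠ "discharged".

STATEMENTS-FIRST (one decl per printed sub-item; Remarks get a REAL decl where the sub-item states a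
claim, fixes notation or has an elementary kernel — which is then PROVED — and are `noted` otherwise):

* **Rmk 3.12.1 (i)** p. 186 l. 6 — "estimates `C_Θ` as in the statement of Corollary 3.12":
  `IsThetaEstimate` (`−|log(Θ)| ≤ C · |log(q)|`), `IsThetaEstimate.mono` ("upper bounds"), and Cor.
  3.12's "i.e." clause in this notation, `neg_one_le_of_estimate` (PROVED: `−|log(q)| ≤ −|log(Θ)|`,
  `|log(q)| > 0` ⟹ every estimate `C` has `C ≥ −1`).
* **Rmk 3.12.1 (ii)** p. 186 l. 8–39 — "generalized Θ^{×μ}_{LGP}-links" `q^λ ↦ q^{(1², …, (l⋇)²)}`,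
  `λ ∈ ℚ_{>0}`: `GeneralizedLink` (exponent data; `standard` = "the case of `λ = 1`";
  `thetaExponent_eq_standard` = "the theory of the first power of the étale theta function is left
  unchanged"); at the level of the two real numbers of Cor. 3.12, `GeneralizedVolumes` with the
  CLAIM-FORM `GeneralizedVolumes.Cor312` ("one may apply the same arguments … to conclude" — NOT
  asserted) and, PROVED from it: `neg_lam_le` ("the inequality `C_Θ ≥ −λ`"), `sharper_iff` ("sharper,
  for `λ < 1`"), `gain_abs_lt_one` ("unaffected by adding a constant of absolute value `≤ 1`").
* **Rmk 3.12.1 (iii)** p. 186 l. 40 – p. 187 l. 7 — the "elementary fact `ℚ_{>0} ∩ Ẑ^× = {1}`" in SET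
  form, `posRat_inter_adelicUnits_eq_singleton`, PROVED from abc-iut-L6-t3's landed
  `Literature.IUT.LogThetaLattice.Rat.eq_one_of_forall_padicValRat_eq_zero` ([IUTchIII] Rmk 2.3.3
  (vi), `RemarksArithmetic.lean`); the "canonical profinite volume"/"canonical unit of volume"
  reading is interpretive prose, quoted in the docstring only.
* **Rmk 3.12.2 (i)** p. 187 l. 9–33 — `noted`: the three "principle examples" (a), (b), (c) of
  "dismantling the two underlying combinatorial dimensions of a number field" are the constructors of
  `DismantlingExample` (docstrings quote them; `DismantlingExample.all_complete`); no mathematical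
  assertion beyond the census.

Census correction read on the page (for abc-iut-dag / c312-2): Remark 3.12.2 has sub-items (i)–(v)
only; plan/DAG.tsv rows `IUTchIII:Rmk3.12.2(vii)`, `(ix)`, `(x)`, `(xi)` are cross-reference tails
("Remark 3.11.1, (vii)" p. 188 l. 47; "Remark 3.9.5, (vii), (viii), (ix), (x)" p. 189 l. 5, p. 194
l. 35/43), not sub-items. Deliberately NOT here: any statement of what Theorem 3.11 delivers (c312-1's
files), the proof chain (c312-2's files), log-volumes/hulls (L6-t4, S2, c312-3, c312-6, c312-7).
-/

namespace Summit.ABC.IUTFork.Cor312Rmk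

/-! ## Remark 3.12.1 (i): "estimates `C_Θ`" -/

/-- **IUTchIII:Rmk3.12.1(i)** (kurims p. 186 l. 6–7): "In [IUTchIV], we shall be concerned with obtaining
more explicit upper bounds on `−|log(Θ)|`, i.e., estimates «`C_Θ`» as in the statement of Corollary
3.12" — where Cor. 3.12 (p. 174) calls `C_Θ ∈ ℝ` any real number "such that `−|log(Θ)| ≤ C_Θ · |log(q)|`".
Typed: `C` is a Θ-ESTIMATE for the pair (`−|log(Θ)|`, `|log(q)|`).
[cite: Mochizuki2012, III Rmk 3.12.1 (i) p.186] -/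
@[claim "Mochizuki2012" "disputed"]
def IsThetaEstimate (negLogTheta absLogQ C : ℝ) : Prop := negLogTheta ≤ C * absLogQ

/-- "upper bounds" (Rmk 3.12.1 (i), p. 186 l. 6): any number above a Θ-estimate is again a Θ-estimate
(`|log(q)| ≥ 0`). PROVED. [cite: Mochizuki2012, III Rmk 3.12.1 (i) p.186] -/
theorem IsThetaEstimate.mono {T a C C' : ℝ} (ha : 0 ≤ a) (h : IsThetaEstimate T a C)
    (hCC' : C ≤ C') : IsThetaEstimate T a C' :=
  le_trans h (mul_le_mul_of_nonneg_right hCC' ha)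

/-- Corollary 3.12's "i.e." clause (kurims p. 174: "`−|log(Θ)| ≥ −|log(q)|` — i.e., `C_Θ ≥ −1` for any real
number `C_Θ ∈ ℝ` such that `−|log(Θ)| ≤ C_Θ · |log(q)|`") in the notation of Rmk 3.12.1 (i): from
`−|log(q)| ≤ −|log(Θ)|` and `|log(q)| > 0`, EVERY Θ-estimate `C` satisfies `−1 ≤ C`. PROVED (this is the
`λ = 1` case of `GeneralizedVolumes.neg_lam_le` below). [cite: Mochizuki2012, III Cor 3.12 p.174] -/
theorem neg_one_le_of_estimate {T a C : ℝ} (ha : 0 < a) (hcor : -a ≤ T)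
    (hC : IsThetaEstimate T a C) : -1 ≤ C := by
  have h : (-1) * a ≤ C * a := by unfold IsThetaEstimate at hC; linarith
  exact le_of_mul_le_mul_right h ha

/-! ## Remark 3.12.1 (ii): generalized Θ^{×μ}_{LGP}-links `q^λ ↦ q^{(1², …, (l⋇)²)}` -/

/-- **IUTchIII:Rmk3.12.1(ii)** (kurims p. 186 l. 8–16), the exponent data of a "generalized Θ^{×μ}_{LGP}-link"
"of the form `q^λ ↦ q^{(1², …, (l⋇)²)}`", "for `λ ∈ ℚ_{>0}`": the `q`-side is raised to the power `λ`, the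
Θ-side carries the exponents `j²`, `j = 1, …, l⋇` (here `j ↔ Fin lstar` via `j = i + 1`).
[cite: Mochizuki2012, III Rmk 3.12.1 (ii) p.186] -/
structure GeneralizedLink (lstar : ℕ) where
  /-- the exponent `λ ∈ ℚ_{>0}` on the `q`-side -/
  lam : ℚ
  /-- `λ > 0` -/
  lam_pos : 0 < lam

namespace GeneralizedLink

variable {lstar : ℕ}

/-- The Θ-side exponents `(1², …, (l⋇)²)` of the display on p. 186 l. 12–16 (independent of `λ`).
[cite: Mochizuki2012, III Rmk 3.12.1 (ii) p.186] -/
def thetaExponent (_L : GeneralizedLink lstar) (i : Fin lstar) : ℚ := (((i : ℕ) + 1 : ℕ) : ℚ) ^ 2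

/-- "the theory developed in the present series of papers corresponds to the case of `λ = 1`" (p. 186
l. 17–18). [cite: Mochizuki2012, III Rmk 3.12.1 (ii) p.186] -/
def standard (lstar : ℕ) : GeneralizedLink lstar := ⟨1, one_pos⟩

/-- `λ = 1` for the standard link. [cite: Mochizuki2012, III Rmk 3.12.1 (ii) p.186] -/
theorem standard_lam : (standard lstar).lam = 1 := rfl

/-- p. 186 l. 21–30: "raising to the `λ`-th power on the «`q` side» differs quite fundamentally from raising
to the `λ`-th power on the «`q^{(1²…(l⋇)²)}` side» … generalized Θ^{×μ}_{LGP}-links as in the above display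
differ fundamentally … in that the theory of the first power of the étale theta function is left
unchanged" — typed: the Θ-side exponents of EVERY generalized link are those of the standard one
(`rfl`). [cite: Mochizuki2012, III Rmk 3.12.1 (ii) p.186] -/
theorem thetaExponent_eq_standard (L : GeneralizedLink lstar) (i : Fin lstar) :
    L.thetaExponent i = (standard lstar).thetaExponent i := rfl

end GeneralizedLink

/-- The two real numbers of Corollary 3.12 in the generalized setting of Rmk 3.12.1 (ii): `−|log(Θ)|`,
`|log(q)| > 0`, together with the exponent `λ ∈ ℚ_{>0}` of the generalized link (p. 186 l. 8–16).
Hypothesis data; nothing about how these numbers arise is typed here (that is Cor. 3.12's statement,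
c312-7's `Cor312Statement.lean`). [cite: Mochizuki2012, III Rmk 3.12.1 (ii) p.186] -/
structure GeneralizedVolumes where
  /-- `λ ∈ ℚ_{>0}` -/
  lam : ℚ
  /-- `λ > 0` -/
  lam_pos : 0 < lam
  /-- `−|log(Θ)| ∈ ℝ` -/
  negLogTheta : ℝ
  /-- `|log(q)| ∈ ℝ` -/
  absLogQ : ℝ
  /-- "`|log(q)| > 0`" (Cor. 3.12, p. 174) -/
  absLogQ_pos : 0 < absLogQ

namespace GeneralizedVolumes

variable (V : GeneralizedVolumes)

/-- CLAIM-FORM (not asserted): p. 186 l. 31–35 "in the case of «generalized Θ^{×μ}_{LGP}-links» as in the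
above display, one may apply the same arguments as the arguments used to prove Corollary 3.12 to
conclude the inequality `C_Θ ≥ −λ`" — at the level of the two real numbers this is the generalized form
`−λ · |log(q)| ≤ −|log(Θ)|` of Cor. 3.12's `−|log(q)| ≤ −|log(Θ)|` (the `q`-pilot raised to the power `λ`).
A `Prop`, to be taken as a hypothesis; its `λ = 1` instance is Cor. 3.12's inequality.
[cite: Mochizuki2012, III Rmk 3.12.1 (ii) p.186] -/
@[claim "Mochizuki2012" "disputed"]
def Cor312 : Prop := -(V.lam : ℝ) * V.absLogQ ≤ V.negLogTheta

/-- "the inequality `C_Θ ≥ −λ`" (p. 186 l. 34–35): PROVED from the claim-form `Cor312` for every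
Θ-estimate `C` (`−λ|log(q)| ≤ −|log(Θ)| ≤ C|log(q)|`, `|log(q)| > 0`).
[cite: Mochizuki2012, III Rmk 3.12.1 (ii) p.186] -/
theorem neg_lam_le (h : V.Cor312) {C : ℝ} (hC : IsThetaEstimate V.negLogTheta V.absLogQ C) :
    -(V.lam : ℝ) ≤ C := by
  have h' : -(V.lam : ℝ) * V.absLogQ ≤ C * V.absLogQ := by
    unfold Cor312 at h; unfold IsThetaEstimate at hC; linarith
  exact le_of_mul_le_mul_right h' V.absLogQ_pos

/-- At `λ = 1` the generalized claim IS Cor. 3.12's `−|log(q)| ≤ −|log(Θ)|` (p. 186 l. 17–18 "corresponds to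
the case of `λ = 1`"). PROVED (`iff`). [cite: Mochizuki2012, III Rmk 3.12.1 (ii) p.186] -/
theorem cor312_iff_of_lam_eq_one (h1 : V.lam = 1) : V.Cor312 ↔ -V.absLogQ ≤ V.negLogTheta := by
  unfold Cor312; rw [h1]; push_cast; rw [neg_one_mul]

/-- "which is sharper, for `λ < 1`, than the inequality obtained in Corollary 3.12 in the case of `λ = 1`"
(p. 186 l. 36–37): `−λ > −1 ⟺ λ < 1`. PROVED. [cite: Mochizuki2012, III Rmk 3.12.1 (ii) p.186] -/
theorem sharper_iff : (-1 : ℝ) < -(V.lam : ℝ) ↔ V.lam < 1 := by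
  constructor
  · intro h; exact_mod_cast (by linarith : (V.lam : ℝ) < 1)
  · intro h; have : (V.lam : ℝ) < 1 := by exact_mod_cast h
    linarith

/-- "such sharper inequalities will not be of interest to us, since, in [IUTchIV], our estimates for the
upper bound `C_Θ` will be sufficiently rough as to be unaffected by adding a constant of absolute value
`≤ 1`" (p. 186 l. 37–39): for `0 < λ < 1` the gain `(−λ) − (−1) = 1 − λ` is a constant of absolute value
`< 1`. PROVED. [cite: Mochizuki2012, III Rmk 3.12.1 (ii) p.186] -/
theorem gain_abs_lt_one (h1 : V.lam < 1) : 0 < -(V.lam : ℝ) - (-1) ∧ |(-(V.lam : ℝ)) - (-1)| < 1 := by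
  have h0 : (0 : ℝ) < V.lam := by exact_mod_cast V.lam_pos
  have h1' : (V.lam : ℝ) < 1 := by exact_mod_cast h1
  refine ⟨by linarith, ?_⟩
  rw [abs_lt]; constructor <;> linarith

end GeneralizedVolumes

/-! ## Remark 3.12.1 (iii): `ℚ_{>0} ∩ Ẑ^× = {1}` -/

/-- **IUTchIII:Rmk3.12.1(iii)** (kurims p. 186 l. 40 – p. 187 l. 7): "the multiradial theory of mono-theta-
theoretic cyclotomic rigidity, and, in particular, the theory of the first power of the étale theta
function, may be regarded as a theory that concerns a sort of «canonical profinite volume» on the elliptic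
curves under consideration … Indeed, the elementary fact «`ℚ_{>0} ∩ Ẑ^× = {1}`», which plays a key role in
the multiradial algorithms for cyclotomic rigidity isomorphisms in the number field case [cf. [IUTchI],
Example 5.1, (v), as well as the discussion of Remarks 2.3.2, 2.3.3 of the present paper], may be regarded
as an immediate consequence of an easy interpretation of the product formula in terms of the geometry of
the domain in the archimedean completion of the number field `ℚ` determined by the inequality «`≤ 1`», i.e.,
a domain which may be thought of as a sort of concrete geometric representation of a «canonical unit of
volume» of the number field `ℚ`." The elementary fact, in SET form (`Ẑ^× ∩ ℚ` = the rationals of `p`-adic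
valuation `0` at every prime): PROVED from abc-iut-L6-t3's landed [IUTchIII] Rmk 2.3.3 (vi) lemma
`Literature.IUT.LogThetaLattice.Rat.eq_one_of_forall_padicValRat_eq_zero`; the "canonical volume" reading
is interpretive and only quoted. [cite: Mochizuki2012, III Rmk 3.12.1 (iii) p.186] -/
theorem posRat_inter_adelicUnits_eq_singleton :
    {q : ℚ | 0 < q ∧ ∀ p : ℕ, p.Prime → padicValRat p q = 0} = {1} := by
  ext q
  simp only [Set.mem_setOf_eq, Set.mem_singleton_iff]
  constructor
  · rintro ⟨hq, h⟩
    exact Literature.IUT.LogThetaLattice.Rat.eq_one_of_forall_padicValRat_eq_zero q hq h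
  · rintro rfl
    exact ⟨one_pos, fun p _ => by simp⟩

/-! ## Remark 3.12.2 (i): the "dismantling" examples (a), (b), (c) — noted -/

/-- **IUTchIII:Rmk3.12.2(i)** (kurims p. 187 l. 9–33) — `noted` (expository): "One of the main themes of the
present series of papers is the issue of dismantling the two underlying combinatorial dimensions of a
number field … The principle examples of this topic may be summarized as follows" — one constructor per
printed example; p. 187 l. 29–33 adds: "From the point of view of Theorem 3.11, example (a) may be seen in
the «non-interference» properties that underlie the log-Kummer correspondences of Theorem 3.11, (ii), (b),
(c), as well as in the Θ^{×μ}_{LGP}-link compatibility properties discussed in Theorem 3.11, (ii), (c),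
(d)" (c312-1's `Thm311LogKummer`/`Thm311LinkCompat` decls). No mathematical assertion is made here.
[cite: Mochizuki2012, III Rmk 3.12.2 (i) p.187] -/
inductive DismantlingExample
  /-- (a) p. 187 l. 14: "splittings of various monoids into unit and value group portions" -/
  | unitValueSplittings
  /-- (b) p. 187 l. 15–23: "separating the «`𝔽_l`» arising from the `l`-torsion points of the elliptic curve
  — which may be thought of as a sort of «finite approximation» of `ℤ`! — into a [multiplicative]
  `𝔽_l^⋇`-symmetry … and a(n) [additive] `𝔽_l^{⋊±}`-symmetry" -/
  | flSymmetries
  /-- (c) p. 187 l. 24–28: "separating the ring structures of the various global number fields that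
  appear into their respective underlying additive structures — which may be related directly to the
  various log-shells that appear — and their respective underlying multiplicative structures — which
  may be related directly to the various Frobenioids that appear" -/
  | additiveMultiplicative
  deriving DecidableEq

/-- The three printed examples, in order. [cite: Mochizuki2012, III Rmk 3.12.2 (i) p.187] -/
def DismantlingExample.all : List DismantlingExample :=
  [.unitValueSplittings, .flSymmetries, .additiveMultiplicative]

/-- Census: three examples (a), (b), (c), listed without repetition and exhaustively. [folklore] -/
theorem DismantlingExample.all_complete (e : DismantlingExample) :
    e ∈ DismantlingExample.all ∧ DismantlingExample.all.length = 3 := by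
  cases e <;> decide

end Summit.ABC.IUTFork.Cor312Rmk
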